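import Literature.Probability.Percolation.QuadCrossingReparam
import Literature.Probability.Percolation.QuadCrossingNullFrontier
import Literature.Topology.PlaneTopology.ConeMapOfLift
import Literature.Probability.RandomPlanarGeometry.ImageUnivalent
import Literature.Probability.RandomPlanarGeometry.RectangleConformalMap
import HarnessLib

/-!
# The conformal square chart of a quad

Topic `Literature/Probability/Percolation`.  Support for the general-position step of
Schramm–Smirnov's Theorem 1.7 (*On the scaling limits of planar percolation*, Ann. Probab. 39
(2011), §2: "approximating if necessary, we can assume that `α` intersects `∂Q₀` at finitely many
points"; §5/Lemma 5.1: "`Q̂₀ : ℂ → ℂ` … e.g., using the Riemann map"): every quad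
`Q : [0,1]² → ℂ`, however wild its parametrisation, is a reparametrisation of a quad whose chart
is *conformal*.  Precisely (`exists_conformalChart`): there are a homeomorphism `H` of `ℂ` and a
side-preserving homeomorphism `k` of `[0,1]²` (`QuadCrossingReparam.lean`) with
`Q = (H ∘ chart) ∘ k`, `H([-1,1]²) = [Q]`, and `H⁻¹` Lipschitz near every point of
`H((-1,1)²) = int [Q]`.  Consequently the members of the perturbation family
`shrinkFamily H …` (`QuadCrossingNullFrontier.lean`) reparametrised by `k` are close to `Q` in
`𝒬_D`, strictly ordered, and have boundaries along which Lipschitz level functions can be pulled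
back — so that a finite-length cut meets almost every one of them in finitely many points
(`BVLevelSets.lean`, `BVComposition.lean`; carried out in the sequel).

Construction.  `H = Φ ∘ R ∘ Ψ⁻¹` where: `Ψ` is the plane homeomorphism extending the
Carathéodory chart of the square `(-1,1)²` (the tree's Riemann map `rectMap 1 1` and its boundary
extension `rectPsi 1 1`, `RectangleConformalMap.lean`; `squareDiscChart`,
`DiscChart.exists_homeomorph_eqOn`), whose boundary correspondence takes the four sides onto the
four quarter-arcs centred at `1, i, -1, -i` (`image_rectPhi_*Side`, from the tree's
`rightArg`/`topArg` monotonicity and the symmetries `Φ(-p) = -Φ(p)`; the corner angle of the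
square is `π/4`, `rectTheta_one_one`); `Φ` is the plane homeomorphism extending a Carathéodory
chart of the Jordan domain `int [Q]` (`JordanDomain.image` of the square under `Q ∘ chart⁻¹`,
`exists_discChart_apply_eq`), composed with complex conjugation if the boundary correspondence
reverses orientation (`exists_strictMono_lift`: an injective loop in the circle has a strictly
increasing lift of degree `±1`, via the tree's continuous logarithm and `strictMono_of_lift`); and
`R` is the bi-Lipschitz cone homeomorphism of the four-knot lift carrying the corner directions
`5/8, 7/8, 9/8, 11/8` (turns) of the square to the corner parameters of `Q`
(`FourKnotLift.lean`, `ConeMapOfLift.lean`), so that `H ∘ chart` and `Q` have the same four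
sides (`sidePreserving_of_image_eq`).  The inverse `H⁻¹ = Ψ ∘ R⁻¹ ∘ Φ⁻¹` is locally Lipschitz on
`int [Q]` because inverse Riemann maps are (`ConformalEquiv.exists_lipschitzOnWith_symm`).

## References

* O. Schramm, S. Smirnov, Ann. Probab. 39 (2011), §2 and proof of Lemma 5.1. [SchrammSmirnov2011]
* Ch. Pommerenke, *Boundary Behaviour of Conformal Maps* (1992), Thm. 2.6, Cor. 2.8.
  [PommerenkeBBCM1992]
-/

noncomputable section

open Set Metric Filter Complex
open scoped unitInterval Topology Real
open Literature.Probability.RandomPlanarGeometry Literature.Topology.PlaneTopology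
open Literature.Topology.PlaneTopology.CircleTwist

namespace Literature.Probability.Percolation

namespace QuadCrossing

/-! ### The affine chart `rectMap 1 1` of the square: injectivity, range, sides -/

/-- The side sets of the parameter square `[0,1]²`. [folklore] -/
def sideSet (i : Fin 4) : Set (I × I) :=
  match i with
  | 0 => {p | p.1 = 0}
  | 1 => {p | p.2 = 0}
  | 2 => {p | p.1 = 1}
  | 3 => {p | p.2 = 1}

/-- The sides of the chart square `[-1,1]²` (left, bottom, right, top). [folklore] -/
def chartSide (i : Fin 4) : Set ℂ :=
  match i with
  | 0 => {z | z.re = -1 ∧ z.im ∈ Icc (-1 : ℝ) 1}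
  | 1 => {z | z.im = -1 ∧ z.re ∈ Icc (-1 : ℝ) 1}
  | 2 => {z | z.re = 1 ∧ z.im ∈ Icc (-1 : ℝ) 1}
  | 3 => {z | z.im = 1 ∧ z.re ∈ Icc (-1 : ℝ) 1}

/-- `Q.side i = Q '' sideSet i`. [folklore] -/
theorem Quad.side_eq_image_sideSet {D : Set ℂ} (Q : Quad D) (i : Fin 4) : Q.side i = Q '' sideSet i := by
  match i with
  | 0 => rfl
  | 1 => rfl
  | 2 => rfl
  | 3 => rfl

/-! ### The conformal chart of the square `(-1, 1)²` -/

/-- The corner angle of the square is `π/4` (quarter-turn symmetry `θ(b,a) = π/2 - θ(a,b)`).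
[folklore] -/
theorem rectTheta_one_one : rectTheta 1 1 one_pos one_pos = π / 4 := by
  have := rectTheta_swap (a := 1) (b := 1) one_pos one_pos
  linarith

/-- `exp (t i) = turn (t / 2π)`. [folklore] -/
theorem exp_mul_I_eq_turn (t : ℝ) : Complex.exp (t * Complex.I) = turn (t / (2 * π)) := by
  rw [turn_eq]; congr 1; push_cast; field_simp

/-- `-turn s = turn (s + 1/2)`. [folklore] -/
theorem neg_turn (s : ℝ) : -turn s = turn (s + 1 / 2) := by
  rw [turn_add, show (1 / 2 : ℝ) = ((π : ℝ)) / (2 * π) by field_simp, ← exp_mul_I_eq_turn,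
    Complex.exp_pi_mul_I, mul_neg, mul_one]

/-- **The Carathéodory chart of the square** `(-1,1)²` from the tree's Riemann map `rectMap 1 1`
and its extension `rectPsi 1 1` (closed disc → closed square, circle → boundary). [folklore] -/
def squareDiscChart : (rectDomain 1 1 one_pos one_pos).DiscChart where
  φ := (rectMap 1 1 one_pos one_pos).symm
  Φ := rectPsi 1 1 one_pos one_pos
  continuousOn := continuousOn_rectPsi one_pos one_pos
  eqOn := rectPsi_eqOn one_pos one_pos
  bijOn := by
    rw [rectDomain_carrier, closure_symRect one_pos one_pos]
    have := bijOn_rectPsi (a := 1) (b := 1) one_pos one_pos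
    rwa [closure_symRect one_pos one_pos] at this
  bijOn_sphere := by
    rw [rectDomain_carrier]
    exact bijOn_rectPsi_sphere one_pos one_pos

/-- The right side of the closed square `[-1,1]²` goes onto the arc `turn [-1/8, 1/8]` under the
boundary correspondence `rectPhi 1 1`. [folklore] -/
theorem image_rectPhi_rightSide :
    rectPhi 1 1 one_pos one_pos '' chartSide 2 = turn '' Icc (-1 / 8 : ℝ) (1 / 8) := by
  show rectPhi 1 1 one_pos one_pos '' {z : ℂ | z.re = 1 ∧ z.im ∈ Icc (-1 : ℝ) 1} = _
  obtain ⟨hc, hi⟩ := continuousOn_injOn_rightArg (a := 1) (b := 1) one_pos one_pos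
  have hmono := strictMonoOn_rightArg (a := 1) (b := 1) one_pos one_pos
  have hθ := rectTheta_one_one
  have htop : rightArg 1 1 one_pos one_pos 1 = π / 4 := by rw [rightArg_top, hθ]
  have hbot : rightArg 1 1 one_pos one_pos (-1) = -(π / 4) := by rw [rightArg_bot, hθ]
  -- the image of the closed side under `rightArg` is the closed interval
  have himg : rightArg 1 1 one_pos one_pos '' Icc (-1 : ℝ) 1 = Icc (-(π / 4)) (π / 4) := by
    refine Subset.antisymm ?_ ?_
    · rintro _ ⟨y, hy, rfl⟩
      exact ⟨hbot ▸ hmono.monotoneOn (left_mem_Icc.2 (by norm_num)) hy hy.1,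
        htop ▸ hmono.monotoneOn hy (right_mem_Icc.2 (by norm_num)) hy.2⟩
    · have := intermediate_value_Icc (show (-1 : ℝ) ≤ 1 by norm_num) hc
      rwa [htop, hbot] at this
  ext w
  constructor
  · rintro ⟨z, ⟨hzre, hzim⟩, rfl⟩
    have hz : z = ⟨1, z.im⟩ := Complex.ext hzre rfl
    have hfr : z ∈ frontier (symRect 1 1) := by rw [hz]; exact right_mem_frontier one_pos one_pos hzim
    rw [rectPhi_eq_exp_arg one_pos one_pos hfr, exp_mul_I_eq_turn]
    refine ⟨arg (rectPhi 1 1 one_pos one_pos z) / (2 * π), ?_, rfl⟩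
    have hmem : arg (rectPhi 1 1 one_pos one_pos z) ∈ Icc (-(π / 4)) (π / 4) := by
      rw [← himg, hz]; exact ⟨z.im, hzim, rfl⟩
    constructor
    · rw [le_div_iff₀ (by positivity)]; nlinarith [hmem.1, Real.pi_pos]
    · rw [div_le_iff₀ (by positivity)]; nlinarith [hmem.2, Real.pi_pos]
  · rintro ⟨s, hs, rfl⟩
    have ht : 2 * π * s ∈ Icc (-(π / 4)) (π / 4) := by
      constructor <;> nlinarith [hs.1, hs.2, Real.pi_pos]
    rw [← himg] at ht
    obtain ⟨y, hy, hyt⟩ := ht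
    refine ⟨⟨1, y⟩, ⟨rfl, hy⟩, ?_⟩
    rw [rectPhi_eq_exp_arg one_pos one_pos (right_mem_frontier one_pos one_pos hy),
      show arg (rectPhi 1 1 one_pos one_pos ⟨1, y⟩) = rightArg 1 1 one_pos one_pos y from rfl, hyt,
      exp_mul_I_eq_turn]
    congr 1; field_simp

/-- The top side goes onto the arc `turn [1/8, 3/8]`. [folklore] -/
theorem image_rectPhi_topSide :
    rectPhi 1 1 one_pos one_pos '' chartSide 3 = turn '' Icc (1 / 8 : ℝ) (3 / 8) := by
  show rectPhi 1 1 one_pos one_pos '' {z : ℂ | z.im = 1 ∧ z.re ∈ Icc (-1 : ℝ) 1} = _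
  obtain ⟨hc, hi⟩ := continuousOn_injOn_topArg (a := 1) (b := 1) one_pos one_pos
  have hanti := strictAntiOn_topArg (a := 1) (b := 1) one_pos one_pos
  have hθ := rectTheta_one_one
  have hr : topArg 1 1 one_pos one_pos 1 = π / 4 := by rw [topArg_right, hθ]
  have hl : topArg 1 1 one_pos one_pos (-1) = 3 * π / 4 := by rw [topArg_left, hθ]; ring
  have himg : topArg 1 1 one_pos one_pos '' Icc (-1 : ℝ) 1 = Icc (π / 4) (3 * π / 4) := by
    refine Subset.antisymm ?_ ?_
    · rintro _ ⟨x, hx, rfl⟩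
      exact ⟨hr ▸ hanti.antitoneOn hx (right_mem_Icc.2 (by norm_num)) hx.2,
        hl ▸ hanti.antitoneOn (left_mem_Icc.2 (by norm_num)) hx hx.1⟩
    · have := intermediate_value_Icc' (show (-1 : ℝ) ≤ 1 by norm_num) hc
      rwa [hr, hl] at this
  ext w
  constructor
  · rintro ⟨z, ⟨hzim, hzre⟩, rfl⟩
    have hz : z = ⟨z.re, 1⟩ := Complex.ext rfl hzim
    have hfr : z ∈ frontier (symRect 1 1) := by rw [hz]; exact top_mem_frontier one_pos one_pos hzre
    rw [rectPhi_eq_exp_arg one_pos one_pos hfr, exp_mul_I_eq_turn]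
    refine ⟨arg (rectPhi 1 1 one_pos one_pos z) / (2 * π), ?_, rfl⟩
    have hmem : arg (rectPhi 1 1 one_pos one_pos z) ∈ Icc (π / 4) (3 * π / 4) := by
      rw [← himg, hz]; exact ⟨z.re, hzre, rfl⟩
    constructor
    · rw [le_div_iff₀ (by positivity)]; nlinarith [hmem.1, Real.pi_pos]
    · rw [div_le_iff₀ (by positivity)]; nlinarith [hmem.2, Real.pi_pos]
  · rintro ⟨s, hs, rfl⟩
    have ht : 2 * π * s ∈ Icc (π / 4) (3 * π / 4) := by
      constructor <;> nlinarith [hs.1, hs.2, Real.pi_pos]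
    rw [← himg] at ht
    obtain ⟨x, hx, hxt⟩ := ht
    refine ⟨⟨x, 1⟩, ⟨rfl, hx⟩, ?_⟩
    rw [rectPhi_eq_exp_arg one_pos one_pos (top_mem_frontier one_pos one_pos hx),
      show arg (rectPhi 1 1 one_pos one_pos ⟨x, 1⟩) = topArg 1 1 one_pos one_pos x from rfl, hxt,
      exp_mul_I_eq_turn]
    congr 1; field_simp

/-- The left side goes onto the arc `turn [3/8, 5/8]` (by the symmetry `Φ(-p) = -Φ(p)`). [folklore] -/
theorem image_rectPhi_leftSide :
    rectPhi 1 1 one_pos one_pos '' chartSide 0 = turn '' Icc (3 / 8 : ℝ) (5 / 8) := by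
  show rectPhi 1 1 one_pos one_pos '' {z : ℂ | z.re = -1 ∧ z.im ∈ Icc (-1 : ℝ) 1} = _
  have hR : rectPhi 1 1 one_pos one_pos '' {z : ℂ | z.re = 1 ∧ z.im ∈ Icc (-1 : ℝ) 1} =
      turn '' Icc (-1 / 8 : ℝ) (1 / 8) := image_rectPhi_rightSide
  have hneg : {z : ℂ | z.re = -1 ∧ z.im ∈ Icc (-1 : ℝ) 1} =
      (fun z => -z) '' {z : ℂ | z.re = 1 ∧ z.im ∈ Icc (-1 : ℝ) 1} := by
    ext z
    simp only [mem_setOf_eq, mem_image]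
    constructor
    · rintro ⟨h1, h2⟩
      refine ⟨-z, ⟨by simp [h1], ?_⟩, neg_neg z⟩
      simpa [neg_le, le_neg, and_comm] using h2
    · rintro ⟨w, ⟨h1, h2⟩, rfl⟩
      refine ⟨by simp [h1], ?_⟩
      simpa [neg_le, le_neg, and_comm] using h2
  rw [hneg, ← image_comp]
  have hcomp : ∀ z ∈ {z : ℂ | z.re = 1 ∧ z.im ∈ Icc (-1 : ℝ) 1},
      (rectPhi 1 1 one_pos one_pos ∘ fun z => -z) z = -rectPhi 1 1 one_pos one_pos z := by
    rintro z ⟨hzre, hzim⟩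
    have hz : z = ⟨1, z.im⟩ := Complex.ext hzre rfl
    have hfr : z ∈ closure (symRect 1 1) := by
      rw [hz]; exact frontier_subset_closure (right_mem_frontier one_pos one_pos hzim)
    exact rectPhi_neg one_pos one_pos hfr
  rw [image_congr hcomp, show (fun z => -rectPhi 1 1 one_pos one_pos z) ''
      {z : ℂ | z.re = 1 ∧ z.im ∈ Icc (-1 : ℝ) 1} = (fun w => -w) ''
      (rectPhi 1 1 one_pos one_pos '' {z : ℂ | z.re = 1 ∧ z.im ∈ Icc (-1 : ℝ) 1}) from
      (image_image _ _ _).symm, hR, image_image]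
  have : (fun s : ℝ => -turn s) = turn ∘ fun s => s + 1 / 2 := by funext s; exact neg_turn s
  rw [this, image_comp, image_add_const_Icc]
  norm_num

/-- The bottom side goes onto the arc `turn [5/8, 7/8]`. [folklore] -/
theorem image_rectPhi_bottomSide :
    rectPhi 1 1 one_pos one_pos '' chartSide 1 = turn '' Icc (5 / 8 : ℝ) (7 / 8) := by
  show rectPhi 1 1 one_pos one_pos '' {z : ℂ | z.im = -1 ∧ z.re ∈ Icc (-1 : ℝ) 1} = _
  have hT : rectPhi 1 1 one_pos one_pos '' {z : ℂ | z.im = 1 ∧ z.re ∈ Icc (-1 : ℝ) 1} =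
      turn '' Icc (1 / 8 : ℝ) (3 / 8) := image_rectPhi_topSide
  have hneg : {z : ℂ | z.im = -1 ∧ z.re ∈ Icc (-1 : ℝ) 1} =
      (fun z => -z) '' {z : ℂ | z.im = 1 ∧ z.re ∈ Icc (-1 : ℝ) 1} := by
    ext z
    simp only [mem_setOf_eq, mem_image]
    constructor
    · rintro ⟨h1, h2⟩
      refine ⟨-z, ⟨by simp [h1], ?_⟩, neg_neg z⟩
      simpa [neg_le, le_neg, and_comm] using h2
    · rintro ⟨w, ⟨h1, h2⟩, rfl⟩
      refine ⟨by simp [h1], ?_⟩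
      simpa [neg_le, le_neg, and_comm] using h2
  rw [hneg, ← image_comp]
  have hcomp : ∀ z ∈ {z : ℂ | z.im = 1 ∧ z.re ∈ Icc (-1 : ℝ) 1},
      (rectPhi 1 1 one_pos one_pos ∘ fun z => -z) z = -rectPhi 1 1 one_pos one_pos z := by
    rintro z ⟨hzim, hzre⟩
    have hz : z = ⟨z.re, 1⟩ := Complex.ext rfl hzim
    have hfr : z ∈ closure (symRect 1 1) := by
      rw [hz]; exact frontier_subset_closure (top_mem_frontier one_pos one_pos hzre)
    exact rectPhi_neg one_pos one_pos hfr
  rw [image_congr hcomp, show (fun z => -rectPhi 1 1 one_pos one_pos z) ''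
      {z : ℂ | z.im = 1 ∧ z.re ∈ Icc (-1 : ℝ) 1} = (fun w => -w) ''
      (rectPhi 1 1 one_pos one_pos '' {z : ℂ | z.im = 1 ∧ z.re ∈ Icc (-1 : ℝ) 1}) from
      (image_image _ _ _).symm, hT, image_image]
  have : (fun s : ℝ => -turn s) = turn ∘ fun s => s + 1 / 2 := by funext s; exact neg_turn s
  rw [this, image_comp, image_add_const_Icc]
  norm_num

/-- The right side again, as the arc `turn [7/8, 9/8]` (one period later). [folklore] -/
theorem image_rectPhi_rightSide' :
    rectPhi 1 1 one_pos one_pos '' chartSide 2 = turn '' Icc (7 / 8 : ℝ) (9 / 8) := by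
  rw [image_rectPhi_rightSide]
  have : (turn : ℝ → ℂ) = turn ∘ fun s => s + 1 := by funext s; exact (turn_add_one s).symm
  conv_lhs => rw [this, image_comp, image_add_const_Icc]
  norm_num

/-- The top side again, as the arc `turn [9/8, 11/8]`. [folklore] -/
theorem image_rectPhi_topSide' :
    rectPhi 1 1 one_pos one_pos '' chartSide 3 = turn '' Icc (9 / 8 : ℝ) (11 / 8) := by
  rw [image_rectPhi_topSide]
  have : (turn : ℝ → ℂ) = turn ∘ fun s => s + 1 := by funext s; exact (turn_add_one s).symm
  conv_lhs => rw [this, image_comp, image_add_const_Icc]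
  norm_num

/-- The left side again, as the arc `turn [11/8, 13/8]`. [folklore] -/
theorem image_rectPhi_leftSide' :
    rectPhi 1 1 one_pos one_pos '' chartSide 0 = turn '' Icc (11 / 8 : ℝ) (13 / 8) := by
  rw [image_rectPhi_leftSide]
  have : (turn : ℝ → ℂ) = turn ∘ fun s => s + 1 := by funext s; exact (turn_add_one s).symm
  conv_lhs => rw [this, image_comp, image_add_const_Icc]
  norm_num

end QuadCrossing

end Literature.Probability.Percolation


namespace Literature.Probability.Percolation

namespace QuadCrossing

/-! ### Lifting an injective loop in the circle to a strictly increasing lift -/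

/-- A `1`-periodic function takes the same value at `t` and `fract t`. [folklore] -/
theorem periodic_apply_fract {β : ℝ → ℂ} (hβp : Function.Periodic β 1) (s : ℝ) :
    β (Int.fract s) = β s := by
  rw [← Int.self_sub_floor, show (s - ⌊s⌋ : ℝ) = s - (⌊s⌋ : ℤ) * (1 : ℝ) by ring]
  exact hβp.sub_int_mul_eq ⌊s⌋

/-- **An injective loop in the unit circle has a strictly increasing lift of degree `±1`**: for
`β : ℝ → ℂ` continuous, `1`-periodic, unit-valued and injective on a period, there is a
continuous strictly increasing `K` with `K (t + 1) = K t + 1` such that either `β t = turn (K t)`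
for all `t` (counterclockwise loop) or `β t = conj (turn (K t))` for all `t` (clockwise loop).
[folklore] -/
theorem exists_strictMono_lift {β : ℝ → ℂ} (hβc : Continuous β) (hβp : Function.Periodic β 1)
    (hβ1 : ∀ t, ‖β t‖ = 1) (hβi : InjOn β (Ico 0 1)) :
    ∃ K : ℝ → ℝ, Continuous K ∧ StrictMono K ∧ (∀ t, K (t + 1) = K t + 1) ∧
      ((∀ t, β t = turn (K t)) ∨ (∀ t, β t = (starRingEnd ℂ) (turn (K t)))) := by
  -- a continuous logarithm of `z ↦ β (re z)`
  set h : ℂ → ℂ := fun z => β z.re with hh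
  have hhc : Continuous h := hβc.comp Complex.continuous_re
  have hh0 : ∀ z, h z ≠ 0 := fun z => by
    rw [← norm_pos_iff, hh]; simp [hβ1]
  obtain ⟨H, hHc, hH⟩ := Janiszewski.exists_continuous_log hhc hh0
  set K₀ : ℝ → ℝ := fun t => (H t).im / (2 * π) with hK₀
  have hK₀c : Continuous K₀ := by
    have : Continuous fun t : ℝ => H t := hHc.comp Complex.continuous_ofReal
    exact (Complex.continuous_im.comp this).div_const _
  have hre : ∀ t : ℝ, Real.exp (H t).re = 1 := fun t => by
    have := congrArg norm (hH t)
    rw [Complex.norm_exp, hh] at this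
    rw [this]
    show ‖β ((t : ℂ)).re‖ = 1
    rw [Complex.ofReal_re, hβ1]
  have hkey : ∀ t : ℝ, β t = turn (K₀ t) := fun t => by
    have h1 : h t = β t := by simp [hh]
    rw [← h1, ← hH t, exp_eq_exp_re_mul_turn, hre]
    simp [hK₀]
  -- the degree
  have hint : ∀ t : ℝ, ∃ n : ℤ, K₀ (t + 1) = K₀ t + n := fun t => by
    have e : turn (K₀ (t + 1)) = turn (K₀ t) := by rw [← hkey, ← hkey, hβp]
    exact turn_eq_turn_iff.1 e
  obtain ⟨d, hd⟩ : ∃ d : ℤ, ∀ t, K₀ (t + 1) = K₀ t + d := by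
    set T : Set ℝ := (AddSubgroup.zmultiples (1 : ℝ) : Set ℝ) with hT
    have hTd : IsDiscrete T :=
      isDiscrete_iff_discreteTopology.2 (NormedSpace.discreteTopology_zmultiples _)
    have hmaps : MapsTo (fun t => K₀ (t + 1) - K₀ t) univ T := fun t _ => by
      obtain ⟨n, hn⟩ := hint t
      rw [hT, SetLike.mem_coe, AddSubgroup.mem_zmultiples_iff]
      refine ⟨n, ?_⟩
      show n • (1 : ℝ) = K₀ (t + 1) - K₀ t
      rw [hn, zsmul_eq_mul, mul_one]; ring
    have hcont : ContinuousOn (fun t => K₀ (t + 1) - K₀ t) univ :=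
      ((hK₀c.comp (continuous_id.add continuous_const)).sub hK₀c).continuousOn
    obtain ⟨d, hd⟩ := hint 0
    refine ⟨d, fun t => ?_⟩
    have := isPreconnected_univ.constant_of_mapsTo hTd hcont hmaps (mem_univ t) (mem_univ 0)
    simp only [zero_add] at this hd
    linarith [this, hd]
  -- injectivity of `β` on a period, read mod `1`
  have hinjβ : ∀ s t, β s = β t → turn s = turn t := by
    intro s t hst
    rw [← periodic_apply_fract hβp s, ← periodic_apply_fract hβp t] at hst
    have hfr : Int.fract s = Int.fract t :=
      hβi ⟨Int.fract_nonneg s, Int.fract_lt_one s⟩ ⟨Int.fract_nonneg t, Int.fract_lt_one t⟩ hst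
    rw [← Int.fract_add_floor s, ← Int.fract_add_floor t, turn_add_intCast, turn_add_intCast, hfr]
  have hinjturn : ∀ s t, turn (K₀ s) = turn (K₀ t) → turn s = turn t := fun s t hst =>
    hinjβ s t (by rw [hkey, hkey, hst])
  have hinjK : InjOn K₀ (Ioo 0 1) := by
    intro s hs t ht hst
    obtain ⟨n, hn⟩ := turn_eq_turn_iff.1 (hinjturn s t (by rw [hst]))
    have h1 : |(n : ℝ)| < 1 := by rw [abs_lt]; constructor <;> linarith [hs.1, hs.2, ht.1, ht.2]
    have hn0 : n = 0 := by
      have : |n| < 1 := by exact_mod_cast h1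
      rw [abs_lt] at this
      omega
    rw [hn, hn0]; simp
  rcases ContinuousOn.strictMonoOn_of_injOn_Ioo zero_lt_one hK₀c.continuousOn hinjK with hm | ha
  · -- counterclockwise
    obtain ⟨_, hmono⟩ := strictMono_of_lift hK₀c hd hm hinjturn
    obtain ⟨hd1, -⟩ := strictMono_of_lift hK₀c hd hm hinjturn
    subst hd1
    exact ⟨K₀, hK₀c, hmono, by simpa using hd, Or.inl hkey⟩
  · -- clockwise: use `-K₀`
    set K : ℝ → ℝ := fun t => -K₀ t with hK
    have hKc : Continuous K := hK₀c.neg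
    have hK1 : ∀ t, K (t + 1) = K t + ((-d : ℤ) : ℝ) := fun t => by
      simp only [hK, hd t]; push_cast; ring
    have hKm : StrictMonoOn K (Ioo 0 1) := ha.neg
    have hKinj : ∀ s t, turn (K s) = turn (K t) → turn s = turn t := by
      intro s t hst
      simp only [hK, turn_neg] at hst
      exact hinjturn s t ((starRingEnd ℂ).injective hst |> fun h => by simpa using h)
    obtain ⟨hd1, hmono⟩ := strictMono_of_lift hKc hK1 hKm hKinj
    refine ⟨K, hKc, hmono, fun t => by rw [hK1 t, hd1]; simp, Or.inr fun t => ?_⟩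
    rw [hkey, show K₀ t = -K t by simp [hK], turn_neg]

/-- A continuous strictly increasing function maps `[a, b]` onto `[K a, K b]`. [folklore] -/
theorem image_Icc_of_strictMono {K : ℝ → ℝ} (hKc : Continuous K) (hKm : StrictMono K) {a b : ℝ}
    (hab : a ≤ b) : K '' Icc a b = Icc (K a) (K b) := by
  refine Subset.antisymm ?_ (intermediate_value_Icc hab hKc.continuousOn)
  rintro _ ⟨t, ht, rfl⟩
  exact ⟨hKm.monotone ht.1, hKm.monotone ht.2⟩

/-- `turn ∘ K` maps `[a, b]` onto the arc `turn [K a, K b]`. [folklore] -/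
theorem image_turn_comp_Icc {K : ℝ → ℝ} (hKc : Continuous K) (hKm : StrictMono K) {a b : ℝ}
    (hab : a ≤ b) : (fun t => turn (K t)) '' Icc a b = turn '' Icc (K a) (K b) := by
  rw [← image_Icc_of_strictMono hKc hKm hab, image_image]

end QuadCrossing

end Literature.Probability.Percolation


namespace Literature.Probability.Percolation

namespace QuadCrossing

/-! ### The affine chart `rectMap 1 1` of the square: injectivity, range -/

/-- The chart `rectMap 1 1` is injective. [folklore] -/
theorem rectMap_one_one_injective : Function.Injective (Quad.rectMap (1 : ℝ) 1) := by
  intro p q h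
  have h1 := congrArg Complex.re h
  have h2 := congrArg Complex.im h
  rw [(Quad.rectMap_re_im 1 1 p).1, (Quad.rectMap_re_im 1 1 q).1] at h1
  rw [(Quad.rectMap_re_im 1 1 p).2, (Quad.rectMap_re_im 1 1 q).2] at h2
  exact Prod.ext (Subtype.ext (by linarith)) (Subtype.ext (by linarith))

/-- The point of the parameter square over a point of `[-1,1]²`. [folklore] -/
def chartInv (z : ℂ) (hz : z ∈ Icc (-1 : ℝ) 1 ×ℂ Icc (-1 : ℝ) 1) : I × I :=
  (⟨(z.re + 1) / 2, by have := (mem_reProdIm.1 hz).1; constructor <;> linarith [this.1, this.2]⟩,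
   ⟨(z.im + 1) / 2, by have := (mem_reProdIm.1 hz).2; constructor <;> linarith [this.1, this.2]⟩)

/-- `rectMap 1 1 (chartInv z) = z`. [folklore] -/
theorem rectMap_chartInv (z : ℂ) (hz : z ∈ Icc (-1 : ℝ) 1 ×ℂ Icc (-1 : ℝ) 1) :
    Quad.rectMap 1 1 (chartInv z hz) = z := by
  apply Complex.ext
  · rw [(Quad.rectMap_re_im 1 1 _).1]; simp [chartInv]; ring
  · rw [(Quad.rectMap_re_im 1 1 _).2]; simp [chartInv]; ring

/-- `rectMap 1 1 p ∈ [-1,1]²`. [folklore] -/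
theorem rectMap_one_one_mem (p : I × I) : Quad.rectMap 1 1 p ∈ Icc (-1 : ℝ) 1 ×ℂ Icc (-1 : ℝ) 1 := by
  rw [mem_reProdIm, (Quad.rectMap_re_im 1 1 p).1, (Quad.rectMap_re_im 1 1 p).2]
  have h1 := p.1.2; have h2 := p.2.2
  simp only [mem_Icc] at h1 h2
  exact ⟨⟨by linarith [h1.1], by linarith [h1.2]⟩, ⟨by linarith [h2.1], by linarith [h2.2]⟩⟩

/-- **The range of the chart is the closed square `[-1,1]²`.** [folklore] -/
theorem range_rectMap_one_one : range (Quad.rectMap (1 : ℝ) 1) = Icc (-1 : ℝ) 1 ×ℂ Icc (-1 : ℝ) 1 := by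
  refine Subset.antisymm (by rintro _ ⟨p, rfl⟩; exact rectMap_one_one_mem p) fun z hz => ?_
  exact ⟨chartInv z hz, rectMap_chartInv z hz⟩

/-- **The chart maps the side sets onto the sides of `[-1,1]²`.** [folklore] -/
theorem image_rectMap_sideSet (i : Fin 4) : Quad.rectMap 1 1 '' sideSet i = chartSide i := by
  have key : ∀ (z : ℂ), z ∈ chartSide i ↔ ∃ p ∈ sideSet i, Quad.rectMap 1 1 p = z := by
    intro z
    constructor
    · intro hz
      have hzS : z ∈ Icc (-1 : ℝ) 1 ×ℂ Icc (-1 : ℝ) 1 := by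
        rw [mem_reProdIm]
        match i, hz with
        | 0, ⟨h1, h2⟩ => exact ⟨by rw [h1]; norm_num, h2⟩
        | 1, ⟨h1, h2⟩ => exact ⟨h2, by rw [h1]; norm_num⟩
        | 2, ⟨h1, h2⟩ => exact ⟨by rw [h1]; norm_num, h2⟩
        | 3, ⟨h1, h2⟩ => exact ⟨h2, by rw [h1]; norm_num⟩
      refine ⟨chartInv z hzS, ?_, rectMap_chartInv z hzS⟩
      match i, hz with
      | 0, ⟨h1, _⟩ => exact Subtype.ext (show ((z.re + 1) / 2 : ℝ) = 0 by rw [h1]; norm_num)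
      | 1, ⟨h1, _⟩ => exact Subtype.ext (show ((z.im + 1) / 2 : ℝ) = 0 by rw [h1]; norm_num)
      | 2, ⟨h1, _⟩ => exact Subtype.ext (show ((z.re + 1) / 2 : ℝ) = 1 by rw [h1]; norm_num)
      | 3, ⟨h1, _⟩ => exact Subtype.ext (show ((z.im + 1) / 2 : ℝ) = 1 by rw [h1]; norm_num)
    · rintro ⟨p, hp, rfl⟩
      have hm := rectMap_one_one_mem p
      rw [mem_reProdIm] at hm
      have hre := (Quad.rectMap_re_im 1 1 p).1
      have him := (Quad.rectMap_re_im 1 1 p).2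
      match i, hp with
      | 0, hp => exact ⟨by rw [hre, show ((p.1 : ℝ)) = 0 from congrArg Subtype.val hp]; norm_num, hm.2⟩
      | 1, hp => exact ⟨by rw [him, show ((p.2 : ℝ)) = 0 from congrArg Subtype.val hp]; norm_num, hm.1⟩
      | 2, hp => exact ⟨by rw [hre, show ((p.1 : ℝ)) = 1 from congrArg Subtype.val hp]; norm_num, hm.2⟩
      | 3, hp => exact ⟨by rw [him, show ((p.2 : ℝ)) = 1 from congrArg Subtype.val hp]; norm_num, hm.1⟩
  ext z; rw [mem_image]; exact (key z).symm

/-! ### The boundary loop of the square: vertices and edges -/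

/-- The piece `[k/4, (k+1)/4]` of the boundary polygon of `(-1,1)²` is the edge from vertex `k`
to vertex `k + 1`. [folklore] -/
theorem image_polygonLoop_rectVerts_piece {k : ℕ} (hk : k < 4) :
    polygonLoop (rectVerts 1 1) '' Icc ((k : ℝ) / 4) (((k : ℝ) + 1) / 4) =
      (fun θ : ℝ => AffineMap.lineMap ((rectVerts (1 : ℝ) 1)[k]'(by simpa using hk))
        ((rectVerts (1 : ℝ) 1)[(k + 1) % 4]'(by simp; omega)) θ) '' Icc (0 : ℝ) 1 := by
  have hlen : (rectVerts (1 : ℝ) 1).length = 4 := rfl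
  have hk' : k < (rectVerts (1 : ℝ) 1).length := by rw [hlen]; exact hk
  have hpar : Icc ((k : ℝ) / 4) (((k : ℝ) + 1) / 4) =
      (fun θ : ℝ => ((k : ℝ) + θ) / (rectVerts (1:ℝ) 1).length) '' Icc (0 : ℝ) 1 := by
    rw [hlen]; push_cast
    ext t
    simp only [mem_Icc, mem_image]
    constructor
    · intro ht; exact ⟨4 * t - k, ⟨by linarith [ht.1], by linarith [ht.2]⟩, by ring⟩
    · rintro ⟨θ, hθ, rfl⟩; constructor <;> linarith [hθ.1, hθ.2]
  rw [hpar, ← image_comp]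
  refine image_congr fun θ hθ => ?_
  have := polygonLoop_apply_div hk' hθ
  simp only [Function.comp_apply]
  rw [this]
  rfl

/-- Edge `0`: the bottom side. [folklore] -/
theorem image_polygonLoop_rectVerts_zero :
    polygonLoop (rectVerts 1 1) '' Icc (0 : ℝ) (1 / 4) = chartSide 1 := by
  have := image_polygonLoop_rectVerts_piece (k := 0) (by norm_num)
  norm_num at this
  rw [this]
  ext z
  simp only [mem_image, mem_Icc, chartSide, mem_setOf_eq]
  constructor
  · rintro ⟨θ, ⟨h0, h1⟩, rfl⟩
    simp [rectVerts, AffineMap.lineMap_apply_module']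
    constructor <;> linarith
  · rintro ⟨hz1, hz2, hz3⟩
    refine ⟨(z.re + 1) / 2, ⟨by linarith, by linarith⟩, ?_⟩
    apply Complex.ext <;> simp [rectVerts, AffineMap.lineMap_apply_module'] <;> linarith

/-- Edge `1`: the right side. [folklore] -/
theorem image_polygonLoop_rectVerts_one :
    polygonLoop (rectVerts 1 1) '' Icc (1 / 4 : ℝ) (1 / 2) = chartSide 2 := by
  have := image_polygonLoop_rectVerts_piece (k := 1) (by norm_num)
  norm_num at this
  rw [this]
  ext z
  simp only [mem_image, mem_Icc, chartSide, mem_setOf_eq]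
  constructor
  · rintro ⟨θ, ⟨h0, h1⟩, rfl⟩
    simp [rectVerts, AffineMap.lineMap_apply_module']
    constructor <;> linarith
  · rintro ⟨hz1, hz2, hz3⟩
    refine ⟨(z.im + 1) / 2, ⟨by linarith, by linarith⟩, ?_⟩
    apply Complex.ext <;> simp [rectVerts, AffineMap.lineMap_apply_module'] <;> linarith

/-- Edge `2`: the top side. [folklore] -/
theorem image_polygonLoop_rectVerts_two :
    polygonLoop (rectVerts 1 1) '' Icc (1 / 2 : ℝ) (3 / 4) = chartSide 3 := by
  have := image_polygonLoop_rectVerts_piece (k := 2) (by norm_num)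
  norm_num at this
  rw [this]
  ext z
  simp only [mem_image, mem_Icc, chartSide, mem_setOf_eq]
  constructor
  · rintro ⟨θ, ⟨h0, h1⟩, rfl⟩
    simp [rectVerts, AffineMap.lineMap_apply_module']
    constructor <;> linarith
  · rintro ⟨hz1, hz2, hz3⟩
    refine ⟨(1 - z.re) / 2, ⟨by linarith, by linarith⟩, ?_⟩
    apply Complex.ext <;> simp [rectVerts, AffineMap.lineMap_apply_module'] <;> linarith

/-- Edge `3`: the left side. [folklore] -/
theorem image_polygonLoop_rectVerts_three :
    polygonLoop (rectVerts 1 1) '' Icc (3 / 4 : ℝ) 1 = chartSide 0 := by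
  have := image_polygonLoop_rectVerts_piece (k := 3) (by norm_num)
  norm_num at this
  rw [this]
  ext z
  simp only [mem_image, mem_Icc, chartSide, mem_setOf_eq]
  constructor
  · rintro ⟨θ, ⟨h0, h1⟩, rfl⟩
    simp [rectVerts, AffineMap.lineMap_apply_module']
    constructor <;> linarith
  · rintro ⟨hz1, hz2, hz3⟩
    refine ⟨(1 - z.im) / 2, ⟨by linarith, by linarith⟩, ?_⟩
    apply Complex.ext <;> simp [rectVerts, AffineMap.lineMap_apply_module'] <;> linarith

end QuadCrossing

end Literature.Probability.Percolation


namespace Literature.Probability.Percolation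

namespace QuadCrossing

open scoped NNReal

/-! ### Side preservation from side images -/

/-- A homeomorphism of the parameter square preserves the sides as soon as two maps that it
intertwines have the same side images. [folklore] -/
theorem sidePreserving_of_image_eq {D : Set ℂ} (Q : Quad D) {G : I × I → ℂ} (hG : Function.Injective G)
    (k : I × I ≃ₜ I × I) (hk : ∀ p, G (k p) = Q p) (himg : ∀ i, G '' sideSet i = Q '' sideSet i) :
    Quad.SidePreserving k := by
  have key : ∀ i p, k p ∈ sideSet i ↔ p ∈ sideSet i := by
    intro i p
    constructor
    · intro h
      have : Q p ∈ Q '' sideSet i := by rw [← himg, ← hk]; exact mem_image_of_mem G h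
      obtain ⟨p', hp', he⟩ := this
      rwa [← Q.injective_toFun he]
    · intro h
      have : G (k p) ∈ G '' sideSet i := by rw [himg, hk]; exact mem_image_of_mem Q h
      obtain ⟨q, hq, he⟩ := this
      rwa [← hG he]
  exact ⟨fun p => key 0 p, fun p => key 1 p, fun p => key 2 p, fun p => key 3 p⟩

/-! ### Local Lipschitz continuity of inverse Riemann maps -/

/-- The inverse of a conformal equivalence is Lipschitz near each point of its (open) target.
[folklore] -/
theorem ConformalEquiv.exists_lipschitzOnWith_symm {U V : Set ℂ} (φ : ConformalEquiv U V) (hV : IsOpen V)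
    {x : ℂ} (hx : x ∈ V) : ∃ C : ℝ≥0, ∃ t ∈ 𝓝 x, LipschitzOnWith C φ.symm t := by
  have hd : DifferentiableOn ℂ φ.symm V := by
    have := φ.differentiableOn_symm
    refine this.congr fun z _ => ?_
    rfl
  exact ((hd.contDiffOn hV).contDiffAt (hV.mem_nhds hx)).exists_lipschitzOnWith

/-! ### The conformal chart -/

/-- **The conformal square chart of a quad.**  For every quad `Q` there are a homeomorphism `H` of
the plane and a side-preserving homeomorphism `k` of the parameter square with
`Q = (H ∘ chart) ∘ k` — so `Q` is a reparametrisation of the quad `H ∘ chart` read through `H` —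
such that `H` carries the closed chart square `[-1,1]²` onto `[Q]` and the inverse `H⁻¹` is
Lipschitz near every point of the image of the open square (it is, up to a bi-Lipschitz cone map
and possibly a reflection, the composite of the Riemann map of `int [Q]` with the inverse Riemann
map of the square).  [cite: SchrammSmirnov2011, proof of Thm. 1.7 (general position); Pommerenke1992, Thm. 2.6] -/
theorem exists_conformalChart {D : Set ℂ} (Q : Quad D) :
    ∃ (H : ℂ ≃ₜ ℂ) (k : I × I ≃ₜ I × I), Quad.SidePreserving k ∧
      (∀ p, H (Quad.rectMap 1 1 (k p)) = Q p) ∧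
      H '' (Icc (-1 : ℝ) 1 ×ℂ Icc (-1 : ℝ) 1) = Q.carrier ∧
      (∀ x ∈ H '' symRect 1 1, ∃ C : ℝ≥0, ∃ t ∈ 𝓝 x, LipschitzOnWith C H.symm t) := by
  classical
  -- the closed chart square and the square Jordan domain
  set S : Set ℂ := Icc (-1 : ℝ) 1 ×ℂ Icc (-1 : ℝ) 1 with hS
  have hcl : closure (symRect 1 1) = S := closure_symRect one_pos one_pos
  set sq : JordanDomain := rectDomain 1 1 one_pos one_pos with hsq
  -- the quad read on the plane: `f = Q ∘ c`
  obtain ⟨c, hcc, hce, hec⟩ := Quad.exists_chart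
  set f : ℂ → ℂ := fun z => Q (c z) with hf
  have hfc : Continuous f := Q.continuous_toFun.comp hcc
  have hfQ : ∀ p, f (Quad.rectMap 1 1 p) = Q p := fun p => by
    simp only [hf, Quad.rectMap_one_one, hce]
  have hfi : InjOn f (closure sq.carrier) := by
    rw [show sq.carrier = symRect 1 1 from rfl, hcl]
    intro z hz z' hz' h
    have h' : c z = c z' := Q.injective_toFun h
    rw [← hec z hz, ← hec z' hz', h']
  have hfS : f '' S = Q.carrier := by
    refine Subset.antisymm ?_ ?_
    · rintro _ ⟨z, -, rfl⟩; exact ⟨c z, rfl⟩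
    · rintro _ ⟨p, rfl⟩
      refine ⟨Quad.rectMap 1 1 p, rectMap_one_one_mem p, hfQ p⟩
  -- the Jordan domain `int [Q]`
  set J : JordanDomain := sq.image f hfc.continuousOn hfi with hJ
  have hJcar : J.carrier = f '' symRect 1 1 := rfl
  have hJbd : J.boundary = f ∘ polygonLoop (rectVerts 1 1) := rfl
  have hJcl : closure J.carrier = Q.carrier := by
    rw [hJ, JordanDomain.closure_carrier_image, show sq.carrier = symRect 1 1 from rfl, hcl, hfS]
  have h0J : f 0 ∈ J.carrier := ⟨0, zero_mem_symRect one_pos one_pos, rfl⟩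
  obtain ⟨CJ, -⟩ := J.exists_discChart_apply_eq h0J
  obtain ⟨Φ, hΦeq, hΦball, hΦsph, hΦcl, -⟩ := CJ.exists_homeomorph_eqOn
  obtain ⟨Ψ, hΨeq, hΨball, hΨsph, hΨcl, -⟩ := squareDiscChart.exists_homeomorph_eqOn
  rw [rectDomain_carrier] at hΨball hΨsph hΨcl
  rw [hcl] at hΨcl
  -- the boundary correspondence and its increasing lift
  obtain ⟨K, hKc, hKm, hK1, hor⟩ :=
    exists_strictMono_lift CJ.continuous_β CJ.periodic_β CJ.norm_β CJ.injOn_β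
  have hΦβ : ∀ t, Φ (CJ.β t) = f (polygonLoop (rectVerts 1 1) t) := fun t => by
    rw [hΦeq (mem_closedBall_zero_iff.2 (CJ.norm_β t).le), CJ.apply_β]; rfl
  -- local Lipschitz continuity of `Φ⁻¹` on `J`
  have hΦsymm : ∀ y ∈ J.carrier, Φ.symm y = CJ.φ.symm y := fun y hy => by
    have hb : CJ.φ.symm y ∈ ball (0 : ℂ) 1 := CJ.φ.symm_mapsTo hy
    rw [Homeomorph.symm_apply_eq]
    rw [hΦeq (ball_subset_closedBall hb), CJ.eqOn hb, CJ.φ.apply_symm_apply hy]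
  have hLΦ : ∀ x ∈ J.carrier, ∃ C : ℝ≥0, ∃ t ∈ 𝓝 x, LipschitzOnWith C Φ.symm t := fun x hx => by
    obtain ⟨C, t, ht, hC⟩ := ConformalEquiv.exists_lipschitzOnWith_symm CJ.φ J.isOpen hx
    refine ⟨C, t ∩ J.carrier, inter_mem ht (J.isOpen.mem_nhds hx), fun y hy z hz => ?_⟩
    rw [hΦsymm y hy.2, hΦsymm z hz.2]
    exact hC hy.1 hz.1
  -- orientation: replace the chart by its reflection if the loop runs clockwise
  set conjH : ℂ ≃ₜ ℂ := Complex.conjCLE.toHomeomorph with hconjH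
  have hconj_apply : ∀ z, conjH z = (starRingEnd ℂ) z := fun z => rfl
  have hconj_symm : ∀ z, conjH.symm z = (starRingEnd ℂ) z := fun z => by
    rw [Homeomorph.symm_apply_eq, hconj_apply, Complex.conj_conj]
  have hconj_norm : ∀ z, ‖conjH z‖ = ‖z‖ := fun z => by rw [hconj_apply, Complex.norm_conj]
  have hconj_ball : conjH '' ball 0 1 = ball 0 1 := Schoenflies.image_ball_eq_of_norm_eq conjH hconj_norm
  have hconj_sphere : conjH '' sphere 0 1 = sphere 0 1 :=
    Schoenflies.image_sphere_eq_of_norm_eq conjH hconj_norm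
  have hconj_closedBall : conjH '' closedBall 0 1 = closedBall 0 1 := by
    rw [← ball_union_sphere, image_union, hconj_ball, hconj_sphere]
  obtain ⟨Φ', hΦ'turn, hΦ'ball, hΦ'cl, hLΦ', hΦ'maps⟩ : ∃ Φ' : ℂ ≃ₜ ℂ,
      (∀ t, Φ' (turn (K t)) = f (polygonLoop (rectVerts 1 1) t)) ∧ Φ' '' ball 0 1 = J.carrier ∧
      Φ' '' closedBall 0 1 = Q.carrier ∧
      (∀ x ∈ J.carrier, ∃ C : ℝ≥0, ∃ t ∈ 𝓝 x, LipschitzOnWith C Φ'.symm t) ∧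
      MapsTo Φ'.symm J.carrier (ball 0 1) := by
    rcases hor with h | h
    · refine ⟨Φ, fun t => by rw [← h, hΦβ], hΦball, by rw [hΦcl, hJcl], hLΦ, fun y hy => ?_⟩
      rw [hΦsymm y hy]; exact CJ.φ.symm_mapsTo hy
    · refine ⟨conjH.trans Φ, fun t => ?_, ?_, ?_, fun x hx => ?_, fun y hy => ?_⟩
      · rw [Homeomorph.trans_apply, hconj_apply, ← h, hΦβ]
      · rw [show ⇑(conjH.trans Φ) = Φ ∘ conjH from rfl, image_comp, hconj_ball, hΦball]
      · rw [show ⇑(conjH.trans Φ) = Φ ∘ conjH from rfl, image_comp, hconj_closedBall, hΦcl, hJcl]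
      · obtain ⟨C, t, ht, hC⟩ := hLΦ x hx
        refine ⟨C, t, ht, fun y hy z hz => ?_⟩
        show edist (conjH.symm (Φ.symm y)) (conjH.symm (Φ.symm z)) ≤ C * edist y z
        rw [hconj_symm, hconj_symm, edist_dist, Complex.dist_conj_conj, ← edist_dist]
        exact hC hy hz
      · show conjH.symm (Φ.symm y) ∈ ball (0 : ℂ) 1
        rw [hconj_symm, mem_ball_zero_iff, Complex.norm_conj, ← mem_ball_zero_iff, hΦsymm y hy]
        exact CJ.φ.symm_mapsTo hy
  -- the four-knot data: standard corner angles `5/8, 7/8, 9/8, 11/8` turns ↦ `K 0, K ¼, K ½, K ¾`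
  set Fk : FourKnots :=
    { x := fun j => (5 + 2 * (j : ℕ)) / 8
      y := fun j => K ((j : ℕ) / 4)
      hx01 := by norm_num
      hx12 := by norm_num
      hx23 := by norm_num
      hx30 := by norm_num
      hy01 := hKm (by norm_num)
      hy12 := hKm (by norm_num)
      hy23 := hKm (by norm_num)
      hy30 := by
        have := hKm (show ((3 : ℕ) : ℝ) / 4 < 0 + 1 by norm_num)
        rw [hK1] at this
        simpa using this } with hFk
  have hxe : ∀ j : Fin 4, Fk.xe (Fin.castSucc j) = (5 + 2 * (j : ℕ)) / 8 := fun j => by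
    rw [FourKnots.xe_castSucc]
  have hxe4 : Fk.xe 4 = 13 / 8 := by
    rw [FourKnots.xe_four]; show (5 + 2 * ((0 : ℕ) : ℝ)) / 8 + 1 = 13 / 8; norm_num
  have hye : ∀ j : Fin 4, Fk.ye (Fin.castSucc j) = K ((j : ℕ) / 4) := fun j => by
    rw [FourKnots.ye_castSucc]
  have hye4 : Fk.ye 4 = K 1 := by
    rw [FourKnots.ye_four]; show K (((0 : ℕ) : ℝ) / 4) + 1 = K 1
    rw [show ((1 : ℝ)) = 0 + 1 by ring, hK1]; simp
  set R : ℂ ≃ₜ ℂ := Fk.coneHomeomorph with hR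
  have hRnorm : ∀ z, ‖R z‖ = ‖z‖ := Fk.norm_coneHomeomorph
  have hRball : R '' ball 0 1 = ball 0 1 := Fk.image_coneHomeomorph_ball
  have hRsphere : R '' sphere 0 1 = sphere 0 1 := Fk.image_coneHomeomorph_sphere
  have hRclosedBall : R '' closedBall 0 1 = closedBall 0 1 := by
    rw [← ball_union_sphere, image_union, hRball, hRsphere]
  -- the arcs: `R (turn [x_j, x_{j+1}]) = turn (K [j/4, (j+1)/4])`
  have harc : ∀ (j : ℕ) (hj : j < 4),
      R '' (turn '' Icc ((5 + 2 * (j : ℝ)) / 8) ((5 + 2 * ((j : ℝ) + 1)) / 8)) =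
        (fun t => turn (K t)) '' Icc ((j : ℝ) / 4) (((j : ℝ) + 1) / 4) := by
    intro j hj
    have key := Fk.image_coneHomeomorph_arc ⟨j, hj⟩
    have e1 : Fk.xe (Fin.castSucc ⟨j, hj⟩) = (5 + 2 * (j : ℝ)) / 8 := by rw [hxe]
    have e2 : Fk.xe (Fin.succ ⟨j, hj⟩) = (5 + 2 * ((j : ℝ) + 1)) / 8 := by
      rcases Nat.lt_succ_iff_lt_or_eq.1 hj |> Or.symm with h3 | h3
      · -- `j = 3`: the last knot
        have : Fin.succ (⟨j, hj⟩ : Fin 4) = 4 := Fin.ext (by simp [h3])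
        rw [this, hxe4, h3]; norm_num
      · have : Fin.succ (⟨j, hj⟩ : Fin 4) = Fin.castSucc ⟨j + 1, by omega⟩ := Fin.ext rfl
        rw [this, hxe]; push_cast; ring
    have e3 : Fk.ye (Fin.castSucc ⟨j, hj⟩) = K ((j : ℝ) / 4) := by rw [hye]
    have e4 : Fk.ye (Fin.succ ⟨j, hj⟩) = K (((j : ℝ) + 1) / 4) := by
      rcases Nat.lt_succ_iff_lt_or_eq.1 hj |> Or.symm with h3 | h3
      · have : Fin.succ (⟨j, hj⟩ : Fin 4) = 4 := Fin.ext (by simp [h3])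
        rw [this, hye4, h3]; norm_num
      · have : Fin.succ (⟨j, hj⟩ : Fin 4) = Fin.castSucc ⟨j + 1, by omega⟩ := Fin.ext rfl
        rw [this, hye]; push_cast; ring_nf
    rw [e1, e2, e3, e4] at key
    rw [hR, key, image_turn_comp_Icc hKc hKm (by linarith)]
  -- `Φ'` on these arcs
  have hΦ'arc : ∀ a b : ℝ, Φ' '' ((fun t => turn (K t)) '' Icc a b) =
      f '' (polygonLoop (rectVerts 1 1) '' Icc a b) := by
    intro a b
    rw [image_image, image_image]
    exact image_congr fun t _ => hΦ'turn t
  -- `Ψ⁻¹` on the closed square is `rectPhi`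
  have hΨsymm : ∀ z ∈ S, Ψ.symm z = rectPhi 1 1 one_pos one_pos z := fun z hz => by
    have hz' : z ∈ closure (symRect 1 1) := by rw [hcl]; exact hz
    rw [Homeomorph.symm_apply_eq, hΨeq (mapsTo_rectPhi one_pos one_pos hz')]
    exact (rectPsi_rectPhi one_pos one_pos hz').symm
  have hside_S : ∀ i, chartSide i ⊆ S := by
    intro i z hz
    rw [hS, mem_reProdIm]
    match i, hz with
    | 0, ⟨h1, h2⟩ => exact ⟨by rw [h1]; norm_num, h2⟩
    | 1, ⟨h1, h2⟩ => exact ⟨h2, by rw [h1]; norm_num⟩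
    | 2, ⟨h1, h2⟩ => exact ⟨by rw [h1]; norm_num, h2⟩
    | 3, ⟨h1, h2⟩ => exact ⟨h2, by rw [h1]; norm_num⟩
  have hΨside : ∀ i, Ψ.symm '' chartSide i = rectPhi 1 1 one_pos one_pos '' chartSide i :=
    fun i => image_congr fun z hz => hΨsymm z (hside_S i hz)
  -- the homeomorphism `H = Φ' ∘ R ∘ Ψ⁻¹`
  set H : ℂ ≃ₜ ℂ := Ψ.symm.trans (R.trans Φ') with hH
  have hHapply : ∀ z, H z = Φ' (R (Ψ.symm z)) := fun z => rfl
  have hHimage : ∀ s : Set ℂ, H '' s = Φ' '' (R '' (Ψ.symm '' s)) := fun s => by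
    rw [show ⇑H = Φ' ∘ R ∘ Ψ.symm from rfl, image_comp, image_comp]
  have hΨsymm_img : ∀ s : Set ℂ, Ψ.symm '' (Ψ '' s) = s := fun s => by
    rw [Homeomorph.image_symm, Homeomorph.preimage_image]
  have hΨsymmS : Ψ.symm '' S = closedBall 0 1 := by rw [← hΨcl, hΨsymm_img]
  have hΨsymm_sq : Ψ.symm '' symRect 1 1 = ball 0 1 := by rw [← hΨball, hΨsymm_img]
  have hHS : H '' S = Q.carrier := by rw [hHimage, hΨsymmS, hRclosedBall, hΦ'cl]
  have hHsq : H '' symRect 1 1 = J.carrier := by rw [hHimage, hΨsymm_sq, hRball, hΦ'ball]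
  -- the side images of `H ∘ chart`
  have hHside : ∀ i, H '' chartSide i = f '' chartSide i := by
    intro i
    rw [hHimage, hΨside]
    match i with
    | 0 =>
        rw [image_rectPhi_leftSide', show (11 / 8 : ℝ) = (5 + 2 * ((3 : ℕ) : ℝ)) / 8 by norm_num,
          show (13 / 8 : ℝ) = (5 + 2 * (((3 : ℕ) : ℝ) + 1)) / 8 by norm_num, harc 3 (by norm_num),
          hΦ'arc, show (((3 : ℕ) : ℝ)) / 4 = 3 / 4 by norm_num,
          show ((((3 : ℕ) : ℝ)) + 1) / 4 = 1 by norm_num, image_polygonLoop_rectVerts_three]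
    | 1 =>
        rw [image_rectPhi_bottomSide, show (5 / 8 : ℝ) = (5 + 2 * ((0 : ℕ) : ℝ)) / 8 by norm_num,
          show (7 / 8 : ℝ) = (5 + 2 * (((0 : ℕ) : ℝ) + 1)) / 8 by norm_num, harc 0 (by norm_num),
          hΦ'arc, show (((0 : ℕ) : ℝ)) / 4 = 0 by norm_num,
          show ((((0 : ℕ) : ℝ)) + 1) / 4 = 1 / 4 by norm_num, image_polygonLoop_rectVerts_zero]
    | 2 =>
        rw [image_rectPhi_rightSide', show (7 / 8 : ℝ) = (5 + 2 * ((1 : ℕ) : ℝ)) / 8 by norm_num,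
          show (9 / 8 : ℝ) = (5 + 2 * (((1 : ℕ) : ℝ) + 1)) / 8 by norm_num, harc 1 (by norm_num),
          hΦ'arc, show (((1 : ℕ) : ℝ)) / 4 = 1 / 4 by norm_num,
          show ((((1 : ℕ) : ℝ)) + 1) / 4 = 1 / 2 by norm_num, image_polygonLoop_rectVerts_one]
    | 3 =>
        rw [image_rectPhi_topSide', show (9 / 8 : ℝ) = (5 + 2 * ((2 : ℕ) : ℝ)) / 8 by norm_num,
          show (11 / 8 : ℝ) = (5 + 2 * (((2 : ℕ) : ℝ) + 1)) / 8 by norm_num, harc 2 (by norm_num),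
          hΦ'arc, show (((2 : ℕ) : ℝ)) / 4 = 1 / 2 by norm_num,
          show ((((2 : ℕ) : ℝ)) + 1) / 4 = 3 / 4 by norm_num, image_polygonLoop_rectVerts_two]
  -- `G = H ∘ chart` and `Q` have the same side images
  set G : I × I → ℂ := fun p => H (Quad.rectMap 1 1 p) with hG
  have hGc : Continuous G := H.continuous.comp (Quad.continuous_rectMap 1 1)
  have hGi : Function.Injective G := H.injective.comp rectMap_one_one_injective
  have hGr : range G = Q.carrier := by
    rw [show G = H ∘ Quad.rectMap 1 1 from rfl, range_comp, range_rectMap_one_one, hHS]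
  have himg : ∀ i, G '' sideSet i = Q '' sideSet i := fun i => by
    rw [show G = H ∘ Quad.rectMap 1 1 from rfl, image_comp, image_rectMap_sideSet, hHside,
      ← image_rectMap_sideSet, ← image_comp]
    exact image_congr fun p _ => hfQ p
  -- the reparametrisation `k = G⁻¹ ∘ Q`
  set eG : I × I ≃ₜ ↥Q.carrier := Continuous.homeoOfEquivCompactToT2
    (f := (Equiv.ofInjective G hGi).trans (Equiv.setCongr hGr)) (continuous_induced_rng.2 hGc) with heG
  set eQ : I × I ≃ₜ ↥Q.carrier := Continuous.homeoOfEquivCompactToT2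
    (f := Equiv.ofInjective Q Q.injective_toFun) (continuous_induced_rng.2 Q.continuous_toFun) with heQ
  have heG_apply : ∀ q, (eG q : ℂ) = G q := fun q => rfl
  have heQ_apply : ∀ p, (eQ p : ℂ) = Q p := fun p => rfl
  set k : I × I ≃ₜ I × I := eQ.trans eG.symm with hk
  have hkG : ∀ p, G (k p) = Q p := fun p => by
    rw [← heG_apply, hk, Homeomorph.trans_apply, Homeomorph.apply_symm_apply, heQ_apply]
  have hkside : Quad.SidePreserving k := sidePreserving_of_image_eq Q hGi k hkG himg
  -- local Lipschitz continuity of `H⁻¹ = Ψ ∘ R⁻¹ ∘ Φ'⁻¹` on `J`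
  have hHsymm : ∀ z, H.symm z = Ψ (R.symm (Φ'.symm z)) := fun z => by
    rw [Homeomorph.symm_apply_eq, hHapply]; simp
  have hΨball_eq : ∀ w ∈ ball (0 : ℂ) 1, Ψ w = (rectMap 1 1 one_pos one_pos).symm w := fun w hw => by
    rw [hΨeq (ball_subset_closedBall hw)]
    exact squareDiscChart.eqOn hw
  obtain ⟨LR, hLR⟩ : ∃ LR : ℝ≥0, LipschitzWith LR R.symm := ⟨_, Fk.lipschitzWith_coneHomeomorph_symm⟩
  have hLip : ∀ x ∈ J.carrier, ∃ C : ℝ≥0, ∃ t ∈ 𝓝 x, LipschitzOnWith C H.symm t := by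
    intro x hx
    obtain ⟨C₁, t₁, ht₁, hC₁⟩ := hLΦ' x hx
    have hy₁ : Φ'.symm x ∈ ball (0 : ℂ) 1 := hΦ'maps hx
    have hy₂ : R.symm (Φ'.symm x) ∈ ball (0 : ℂ) 1 := by
      rw [mem_ball_zero_iff, ← hRnorm, Homeomorph.apply_symm_apply, ← mem_ball_zero_iff]; exact hy₁
    obtain ⟨C₃, t₃, ht₃, hC₃⟩ :=
      ConformalEquiv.exists_lipschitzOnWith_symm (rectMap 1 1 one_pos one_pos) isOpen_ball hy₂
    set t : Set ℂ := t₁ ∩ (fun z => R.symm (Φ'.symm z)) ⁻¹' (t₃ ∩ ball 0 1) with ht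
    have htx : t ∈ 𝓝 x := by
      refine inter_mem ht₁ ?_
      refine (R.symm.continuous.comp Φ'.symm.continuous).continuousAt.preimage_mem_nhds ?_
      exact inter_mem ht₃ (isOpen_ball.mem_nhds hy₂)
    refine ⟨C₃ * (LR * C₁), t, htx, ?_⟩
    have h12 : LipschitzOnWith (LR * C₁) (fun z => R.symm (Φ'.symm z)) t :=
      (hLR.comp_lipschitzOnWith hC₁).mono inter_subset_left
    have h3 : LipschitzOnWith C₃ Ψ (t₃ ∩ ball 0 1) := fun w hw w' hw' => by
      rw [hΨball_eq w hw.2, hΨball_eq w' hw'.2]; exact hC₃ hw.1 hw'.1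
    have hcomp := h3.comp h12 fun z hz => hz.2
    intro z hz z' hz'
    rw [hHsymm, hHsymm]
    exact hcomp hz hz'
  refine ⟨H, k, hkside, fun p => hkG p, hHS, fun x hx => hLip x ?_⟩
  rwa [hHsq] at hx


end QuadCrossing

end Literature.Probability.Percolation

end
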